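import Summits.BirchSwinnertonDyer.BirchSwinnertonDyer.Theorems.BiquadraticEisensteinDescentHeegnerTwistCouplingInSupplyLinnikCensusGeneral
import Summits.BirchSwinnertonDyer.BirchSwinnertonDyer.Theorems.BiquadraticEisensteinDescentHeegnerTwistCouplingInSupplyCornersThreeFacts
import Mathlib.Data.Nat.Choose.Bounds
import HarnessLib

set_option linter.dupNamespace false -- `Summit.BirchSwinnertonDyer.BirchSwinnertonDyer.Theorems.…` (summit = sub)
set_option autoImplicit false

/-!
# Crux `HeegnerTwistCouplingInSupply` (stmt-BirchSwinnertonDyer-21381) — card `linnik-sieve-residual-census`: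
# the `E_p` corner (`j = 1728`, `p ≡ 7 (mod 8)`) — its located-partner residual is `O(log⁸ Q)`, UNCONDITIONALLY

Route `BiquadraticEisensteinDescent` (cell `pub/bsd-wall`, width seat `bsd-wall-cm-bed-w3` g19; `--supports` 21381, helper).
The door `…CornersThreeFacts.cruxOnEpCorner_of_three_facts` (modulo Monsky-odd + Burungale–Tian + Burungale–Flach) covers the
primes `p ≡ 7 (mod 8)` having a SMALL partner (`p ≡ 2 (3)`, `±2 (5)`, `(p/11) = −1`, …, `63/64` of the class); its engine
`cellData_partnerQ` accepts ANY prime partner `q₀ ≡ 3 (mod 8)` with `(p/q₀) = −1` below the class-number-formula threshold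
`8⁸ (2q₀)⁵ ≤ (eπ)⁸ p³` — so the residual of that rung is exactly a LOCATED-PRIME residual in the sense of the card
`Ideas/linnik-sieve-residual-census.md` §«Two or three simultaneous located conditions»: «no prime `q₀ ≤ Q^{1/4}`,
`q₀ ≡ 3 (mod 8)`, with `(p/q₀) = −1`». This file runs the card's census on it with the general engines of
`…LinnikCensusGeneral.lean`: amplifier = products of EIGHT distinct class-`3 (mod 8)` primes `≤ ⌊⌊√Q⌋^{1/2}⌋` (`≤ Q²`), each
a non-residue modulo an exceptional `p` by reciprocity at `p ≡ q₀ ≡ 3 (mod 4)`; Montgomery's arithmetic large sieve (tree,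
proved) and the PNT for `3 (mod 8)` (tree, proved) give

* ★ `residualCensusEp` — `∃ C > 0, ∀ Q ≥ 3, #{p ≤ Q prime, p ≡ 7 (8), ⌊√Q⌋ < p, no partner q₀ ≤ ⌊⌊√Q⌋^{1/2}⌋} ≤ C (log Q)⁸`;
* `cruxOnEpCorner_of_cellData_of_three_facts` — the door's generic tail: cell data `(q, l)` ⇒ the crux conclusion for `E_p`;
* ★★ `cruxConclusion_Ep_allBut_of_three_facts` — modulo EXACTLY the door's three facts, for every `Q ≥ 3` an exceptional set of
  `≤ C (log Q)⁸` naturals outside which EVERY prime `p ≡ 7 (mod 8)`, `⌊√Q⌋ < p ≤ Q`, satisfies the conclusion of crux 21381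
  for `W = E_p : y² = x³ − p²x` (Heegner `K′` of `N(E_p)`, `4 < |d_{K′}|`, `L(E_p^{(d_{K′})},1) ≠ 0`, `h(K′) < p`, `p ∤ h(K′)`).

This is the quantitative complement of LEAD-VERDICT-ibd-p1-g11 §4 (i) («a Chebotarev ladder of explicit small partners covers the
class rung by rung, never all p»): the primes missed by EVERY partner `≤ Q^{1/4}` are polylog-sparse. HONEST FRAMING: RUNG-LEVEL,
one corner family; the crux as stated (all CM `W`, all `p ≥ 5`; residual C⁺), its registered stubs and BSD are NOT touched;
nothing is closed. THEOREMS ONLY (no `def`); constants not optimised.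
-/

namespace Summit.BirchSwinnertonDyer.BirchSwinnertonDyer.Theorems.LinnikCensus

open Finset
open Literature.NumberTheory.EllipticCurves Literature.NumberTheory.EllipticCurves.HeathBrown1994
  Literature.NumberTheory.EllipticCurves.HeathBrown1994.Families
  Literature.NumberTheory.QuadraticFields Literature.NumberTheory.QuadraticFields.Quadratic
  Summit.BirchSwinnertonDyer.BirchSwinnertonDyer.Theorems.BiquadraticEisensteinDescentHeegnerTwistCouplingInSupplyMonskyCells
  Summit.BirchSwinnertonDyer.BirchSwinnertonDyer.Theorems.BiquadraticEisensteinDescentHeegnerTwistCouplingInSupplyThreeSquaresPinRankZero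
  Summit.BirchSwinnertonDyer.BirchSwinnertonDyer.Theorems.BiquadraticEisensteinDescentHeegnerTwistCouplingInSupplyThreeSquaresPinCorner
  Summit.BirchSwinnertonDyer.BirchSwinnertonDyer.Theorems.BiquadraticEisensteinDescentHeegnerTwistCouplingInSupplyIndefinitePinWitness
  Summit.BirchSwinnertonDyer.BirchSwinnertonDyer.Theorems.BiquadraticEisensteinDescentHeegnerTwistCouplingInSupplyPartnerLadder
  Summit.BirchSwinnertonDyer.BirchSwinnertonDyer.Theorems.BiquadraticEisensteinDescentHeegnerTwistCouplingInSupplyCornersE2pFourFacts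
  Summit.BirchSwinnertonDyer.BirchSwinnertonDyer.Theorems.BiquadraticEisensteinDescentHeegnerTwistCouplingInSupplyCornersEpFourFacts
  Summit.BirchSwinnertonDyer.BirchSwinnertonDyer.Theorems.BiquadraticEisensteinDescentHeegnerTwistCouplingInSupplyCornersThreeFacts

/-! ## Supply and arithmetic at height `Q^{1/4}`, amplifier length `8` -/

/-- **The class-`3 (mod 8)` supply with slack `7`**: for all large `y`, `y/(16 log y) + 7 ≤ #{q ≤ y prime : q ≡ 3 (mod 8)}`
(PNT lower bound `y/(8 log y)` from `exists_card_primesMod_mul_log_ge 8 3`, `φ(8) = 4`, minus the slack absorbed by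
`112 log y ≤ y`). [cite: MontgomeryVaughan2007, Cor. 11.17] -/
theorem exists_card_locPrimes_three_mod_eight_ge :
    ∃ y₀ : ℕ, 2 ≤ y₀ ∧ ∀ y : ℕ, y₀ ≤ y →
      (y : ℝ) / (16 * Real.log y) + 7 ≤ (((Finset.Icc 1 y).filter (fun q : ℕ => q.Prime ∧ q % 8 = 3)).card : ℝ) := by
  have ha : IsUnit (((3 : ℕ) : ZMod 8)) := (ZMod.isUnit_iff_coprime 3 8).mpr (by norm_num)
  obtain ⟨X₀, hX₀⟩ := exists_card_primesMod_mul_log_ge 8 3 ha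
  obtain ⟨y₁, hy₁⟩ := exists_const_mul_log_le 112
  have hφ : (((8 : ℕ).totient : ℕ) : ℝ) = 4 := by
    have : (8 : ℕ).totient = 4 := by decide
    rw [this]; norm_num
  refine ⟨max (max X₀ y₁) 2, le_max_right _ _, fun y hy => ?_⟩
  have hyX : X₀ ≤ y := le_trans (le_trans (le_max_left _ _) (le_max_left _ _)) hy
  have hyy : y₁ ≤ y := le_trans (le_trans (le_max_right _ _) (le_max_left _ _)) hy
  have hy2 : (2 : ℝ) ≤ y := by exact_mod_cast le_trans (le_max_right _ _) hy
  have hlog : 0 < Real.log y := Real.log_pos (by linarith)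
  have h1 := hX₀ y hyX
  rw [hφ, show (3 : ℕ) % 8 = 3 by norm_num] at h1
  have h2 := hy₁ y hyy
  set k : ℝ := (((Finset.Icc 1 y).filter (fun q : ℕ => q.Prime ∧ q % 8 = 3)).card : ℝ) with hk
  rw [div_add' _ _ _ (by positivity), div_le_iff₀ (by positivity)]
  nlinarith [h1, h2, hlog]

/-- **Real-arithmetic core, amplifier length `8`**: if `t = y/(16 log y) ≥ 1`, `k ≥ t + 7`, `E ≤ 4Q²/C(k,8)` and
`Q² ≤ 256 y⁸`, then `E ≤ 4·256·40320·16⁸ · (log y)⁸` (`C(k,8) ≥ (k−7)⁸/8! ≥ t⁸/40320`). [folklore] -/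
theorem census_arith8 {Q y k : ℕ} {E : ℝ} (hlog : 0 < Real.log y) (ht : 1 ≤ (y : ℝ) / (16 * Real.log y))
    (hk : (y : ℝ) / (16 * Real.log y) + 7 ≤ (k : ℝ)) (hQy : (Q : ℝ) ^ 2 ≤ 256 * (y : ℝ) ^ 8)
    (hE : E ≤ 4 * (Q : ℝ) ^ 2 / (k.choose 8 : ℕ)) :
    E ≤ 4 * 256 * 40320 * 16 ^ 8 * Real.log y ^ 8 := by
  set t : ℝ := (y : ℝ) / (16 * Real.log y) with htdef
  have hk7 : 7 ≤ k := by
    have : (7 : ℝ) ≤ k := by linarith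
    exact_mod_cast this
  have hchoose : ((k - 7 : ℕ) : ℝ) ^ 8 / 40320 ≤ (k.choose 8 : ℕ) := by
    have h := Nat.pow_le_choose (α := ℝ) 8 k
    have h87 : k + 1 - 8 = k - 7 := by omega
    rw [h87, show (Nat.factorial 8 : ℝ) = 40320 by norm_num [Nat.factorial]] at h
    exact_mod_cast h
  have hkt : t ≤ ((k - 7 : ℕ) : ℝ) := by
    rw [Nat.cast_sub hk7]; push_cast; linarith
  have ht0 : 0 ≤ t := le_trans zero_le_one ht
  have ht8 : t ^ 8 / 40320 ≤ (k.choose 8 : ℕ) := le_trans (by gcongr) hchoose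
  have htpos : 0 < t ^ 8 / 40320 := by positivity
  have hty : t * (16 * Real.log y) = y := by
    rw [htdef]; field_simp
  calc E ≤ 4 * (Q : ℝ) ^ 2 / (k.choose 8 : ℕ) := hE
    _ ≤ 4 * (Q : ℝ) ^ 2 / (t ^ 8 / 40320) := by gcongr
    _ ≤ 4 * (256 * (y : ℝ) ^ 8) / (t ^ 8 / 40320) := by gcongr
    _ = 4 * 256 * 40320 * (y : ℝ) ^ 8 / t ^ 8 := by field_simp
    _ = 4 * 256 * 40320 * (t * (16 * Real.log y)) ^ 8 / t ^ 8 := by rw [hty]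
    _ = 4 * 256 * 40320 * 16 ^ 8 * Real.log y ^ 8 := by
        have ht' : t ^ 8 ≠ 0 := by positivity
        rw [mul_pow, mul_comm (t ^ 8) _, ← mul_assoc, mul_div_assoc, div_self ht', mul_one]
        ring

/-- `⌊√Q⌋` and `y = ⌊⌊√Q⌋^{1/2}⌋`: `y⁸ ≤ Q²` and `Q² ≤ 256 y⁸` (for `y ≥ 1`). [folklore] -/
theorem sqrt_sqrt_bounds (Q : ℕ) (hy : 1 ≤ Nat.sqrt (Nat.sqrt Q)) :
    Nat.sqrt (Nat.sqrt Q) ^ 8 ≤ Q ^ 2 ∧ ((Q : ℝ) ^ 2 ≤ 256 * ((Nat.sqrt (Nat.sqrt Q) : ℕ) : ℝ) ^ 8) := by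
  set y' := Nat.sqrt Q with hy'
  set y := Nat.sqrt y' with hyd
  have h1 : y ^ 2 ≤ y' := Nat.sqrt_le' y'
  have h2 : y' ^ 2 ≤ Q := Nat.sqrt_le' Q
  have h3 : Q < (y' + 1) ^ 2 := Nat.lt_succ_sqrt' Q
  have h4 : y' < (y + 1) ^ 2 := Nat.lt_succ_sqrt' y'
  constructor
  · calc y ^ 8 = ((y ^ 2) ^ 2) ^ 2 := by ring
      _ ≤ (y' ^ 2) ^ 2 := by gcongr
      _ ≤ Q ^ 2 := by gcongr
  · have h5 : y' + 1 ≤ (y + 1) ^ 2 := h4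
    have h6 : Q ≤ (y' + 1) ^ 2 := h3.le
    have h7 : Q ≤ ((y + 1) ^ 2) ^ 2 := h6.trans (Nat.pow_le_pow_left h5 2)
    have h8 : (y + 1) ≤ 2 * y := by omega
    have h9 : Q ≤ (2 * y) ^ 4 := by
      calc Q ≤ ((y + 1) ^ 2) ^ 2 := h7
        _ = (y + 1) ^ 4 := by ring
        _ ≤ (2 * y) ^ 4 := Nat.pow_le_pow_left h8 4
    have h10 : (Q : ℝ) ≤ ((2 * y : ℕ) : ℝ) ^ 4 := by exact_mod_cast h9
    calc (Q : ℝ) ^ 2 ≤ (((2 * y : ℕ) : ℝ) ^ 4) ^ 2 := by gcongr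
      _ = 256 * ((y : ℕ) : ℝ) ^ 8 := by push_cast; ring

/-! ## The census for the `E_p` located-partner residual -/

open scoped Classical in
/-- ★ **`residualCensusEp`**: there is `C > 0` such that for every `Q ≥ 3` the number of primes `p ≤ Q`, `p ≡ 7 (mod 8)`,
`⌊√Q⌋ < p`, with NO partner `q₀ ≤ ⌊⌊√Q⌋^{1/2}⌋` (`q₀` prime, `q₀ ≡ 3 (mod 8)`, `(p/q₀) = −1`) is at most `C · (log Q)⁸`.
Proof: on such a `p` every class-`3 (mod 8)` prime `q ≤ Q^{1/4}` has `(p/q) = +1`, hence `(q/p) = −1` (reciprocity, both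
`≡ 3 (mod 4)`); the general amplifier sieve `card_le_of_nonresidue_amplifier` (length `8`, height `Q^{1/4}`) and the supply
`exists_card_locPrimes_three_mod_eight_ge` give `#exc ≤ 4Q²/C(#L,8) ≤ C (log Q)⁸`; small `Q` by the trivial bound.
[cite: Montgomery1978, p. 561] [cite: MontgomeryVaughan2007, Cor. 11.17] -/
theorem residualCensusEp :
    ∃ C : ℝ, 0 < C ∧ ∀ Q : ℕ, 3 ≤ Q →
      ((((Finset.range (Q + 1)).filter (fun p : ℕ => p.Prime ∧ p % 8 = 7 ∧ Nat.sqrt Q < p ∧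
          ∀ q : ℕ, q.Prime → q % 8 = 3 → q ≤ Nat.sqrt (Nat.sqrt Q) → jacobiSym (p : ℤ) q ≠ -1)).card : ℝ))
        ≤ C * Real.log Q ^ 8 := by
  obtain ⟨y₀, hy₀2, hy₀⟩ := exists_card_locPrimes_three_mod_eight_ge
  obtain ⟨y₁, hy₁⟩ := exists_const_mul_log_le 16
  set Q₀ : ℕ := ((max y₀ y₁) ^ 2) ^ 2 with hQ₀
  set C₀ : ℝ := 4 * 256 * 40320 * 16 ^ 8 with hC₀
  refine ⟨max C₀ ((Q₀ : ℝ) + 1), lt_max_of_lt_left (by norm_num [hC₀]), fun Q hQ3 => ?_⟩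
  have hlog3 : 1 ≤ Real.log Q := by
    have hQ3' : (3 : ℝ) ≤ Q := by exact_mod_cast hQ3
    have he : Real.exp 1 ≤ (Q : ℝ) := le_trans (le_of_lt (lt_trans Real.exp_one_lt_d9 (by norm_num))) hQ3'
    rwa [← Real.log_le_log_iff (Real.exp_pos 1) (by linarith), Real.log_exp] at he
  have hlog8 : 1 ≤ Real.log Q ^ 8 := one_le_pow₀ hlog3
  by_cases hQ : Q₀ ≤ Q
  · set y := Nat.sqrt (Nat.sqrt Q) with hydef
    have hyge : max y₀ y₁ ≤ y := by
      rw [hydef, Nat.le_sqrt', Nat.le_sqrt']; exact hQ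
    have hyy₀ : y₀ ≤ y := le_trans (le_max_left _ _) hyge
    have hyy₁ : y₁ ≤ y := le_trans (le_max_right _ _) hyge
    have hy2 : 2 ≤ y := le_trans hy₀2 hyy₀
    have hy2' : (2 : ℝ) ≤ y := by exact_mod_cast hy2
    have hlogy : 0 < Real.log y := Real.log_pos (by linarith)
    have hk := hy₀ y hyy₀
    have h16 := hy₁ y hyy₁
    have ht : 1 ≤ (y : ℝ) / (16 * Real.log y) := by
      rw [le_div_iff₀ (by positivity)]; linarith
    set L := (Finset.Icc 1 y).filter (fun q : ℕ => q.Prime ∧ q % 8 = 3) with hLdef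
    have hk8 : 1 ≤ L.card.choose 8 := by
      have h8 : (8 : ℝ) ≤ (L.card : ℝ) := by linarith
      have h8' : 8 ≤ L.card := by exact_mod_cast h8
      exact Nat.choose_pos h8'
    obtain ⟨hy8, hQy⟩ := sqrt_sqrt_bounds Q (by omega)
    have hyle : y ≤ Nat.sqrt Q := Nat.sqrt_le_self _
    set P := (Finset.range (Q + 1)).filter (fun p : ℕ => p.Prime ∧ p % 8 = 7 ∧ Nat.sqrt Q < p ∧
          ∀ q : ℕ, q.Prime → q % 8 = 3 → q ≤ Nat.sqrt (Nat.sqrt Q) → jacobiSym (p : ℤ) q ≠ -1) with hPdef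
    have hP : ∀ p ∈ P, p.Prime ∧ p ≠ 2 ∧ p ≤ Q := by
      intro p hp
      rw [hPdef, Finset.mem_filter, Finset.mem_range] at hp
      exact ⟨hp.2.1, by omega, by omega⟩
    have hL : ∀ q ∈ L, q.Prime ∧ q ≤ y := by
      intro q hq
      rw [hLdef, Finset.mem_filter, Finset.mem_Icc] at hq
      exact ⟨hq.2.1, hq.1.2⟩
    have hPL : ∀ p ∈ P, ∀ q ∈ L, jacobiSym (q : ℤ) p = -1 := by
      intro p hp q hq
      rw [hPdef, Finset.mem_filter, Finset.mem_range] at hp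
      obtain ⟨-, hpp, hp8, hyp, hno⟩ := hp
      rw [hLdef, Finset.mem_filter, Finset.mem_Icc] at hq
      obtain ⟨⟨-, hqy⟩, hqp, hq8⟩ := hq
      have hne : q ≠ p := by omega
      have hcop : Int.gcd (p : ℤ) q = 1 := by
        rw [Int.gcd_natCast_natCast]
        exact (Nat.coprime_primes hpp hqp).mpr (Ne.symm hne)
      have hone : jacobiSym (p : ℤ) q = 1 := by
        rcases jacobiSym.eq_one_or_neg_one hcop with h | h
        · exact h
        · exact absurd h (hno q hqp hq8 hqy)
      rw [jacobiSym.quadratic_reciprocity_three_mod_four (by omega) (by omega), hone]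
    have hE := card_le_of_nonresidue_amplifier (by omega) hy8 (by decide) P L hP hL hPL hk8
    have hmain := census_arith8 hlogy ht hk hQy hE
    have hlogyQ : Real.log y ≤ Real.log Q := by
      apply Real.log_le_log (by linarith)
      exact_mod_cast (hyle.trans (Nat.sqrt_le_self Q))
    calc (P.card : ℝ) ≤ C₀ * Real.log y ^ 8 := by rw [hC₀]; exact hmain
      _ ≤ C₀ * Real.log Q ^ 8 := by
          have hC₀0 : (0 : ℝ) ≤ C₀ := by norm_num [hC₀]
          exact mul_le_mul_of_nonneg_left (pow_le_pow_left₀ hlogy.le hlogyQ 8) hC₀0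
      _ ≤ max C₀ ((Q₀ : ℝ) + 1) * Real.log Q ^ 8 :=
          mul_le_mul_of_nonneg_right (le_max_left _ _) (by positivity)
  · have hQ' : Q < Q₀ := not_le.mp hQ
    have hcard : (((Finset.range (Q + 1)).filter (fun p : ℕ => p.Prime ∧ p % 8 = 7 ∧ Nat.sqrt Q < p ∧
        ∀ q : ℕ, q.Prime → q % 8 = 3 → q ≤ Nat.sqrt (Nat.sqrt Q) → jacobiSym (p : ℤ) q ≠ -1)).card : ℝ)
          ≤ (Q₀ : ℝ) + 1 := by
      have h1 := Finset.card_filter_le (Finset.range (Q + 1)) (fun p : ℕ => p.Prime ∧ p % 8 = 7 ∧ Nat.sqrt Q < p ∧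
        ∀ q : ℕ, q.Prime → q % 8 = 3 → q ≤ Nat.sqrt (Nat.sqrt Q) → jacobiSym (p : ℤ) q ≠ -1)
      rw [Finset.card_range] at h1
      have : (Q : ℝ) + 1 ≤ (Q₀ : ℝ) + 1 := by
        have := hQ'.le; exact_mod_cast Nat.succ_le_succ this
      calc _ ≤ ((Q + 1 : ℕ) : ℝ) := by exact_mod_cast h1
        _ = (Q : ℝ) + 1 := by push_cast; ring
        _ ≤ (Q₀ : ℝ) + 1 := this
    calc _ ≤ (Q₀ : ℝ) + 1 := hcard
      _ ≤ max C₀ ((Q₀ : ℝ) + 1) := le_max_right _ _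
      _ = max C₀ ((Q₀ : ℝ) + 1) * 1 := (mul_one _).symm
      _ ≤ max C₀ ((Q₀ : ℝ) + 1) * Real.log Q ^ 8 :=
          mul_le_mul_of_nonneg_left hlog8 (le_trans (by positivity) (le_max_right _ _))

/-! ## The door: cell data ⇒ the crux conclusion for `E_p`, modulo the three descent facts -/

/-- **The door's generic tail** (`cruxOnEpCorner_of_three_facts` with the cell data as a HYPOTHESIS instead of the ladder
`exists_cellData_p`): given primes `q ≡ 3`, `l ≡ 5 (mod 8)` with `(q/p) = +1`, `(l/p) = −1` and `h(K) < p` for every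
imaginary quadratic `K` of discriminant `−ql`, the conclusion of crux 21381 holds for `W = E_p` (`p ≡ 7 (mod 8)`), modulo
Monsky (odd) + Burungale–Tian + Burungale–Flach (Monsky matrix of the cell has odd determinant ⇒ `L(E_{pql}, 1) ≠ 0`;
`K′ = ℚ(√−ql)` is Heegner for `N(E_p) ∣ (2p)^∞`). [cite: HeathBrown1994SelmerCongruentII, Appendix (Monsky), typescript
p. 39 L27–L33] [cite: BurungaleTian2026, Thm. 1.1] [cite: BurungaleFlach2024, Thm. 1.1 and Cor. 2] -/
theorem cruxOnEpCorner_of_cellData_of_three_facts (hM : monsky_card_selmerGroup_two_odd)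
    (hBT : burungaleTian_analyticRank_eq_zero_of_selmerCorank_eq_zero_of_hasCM) (hBF : bsdTriple_of_hasCM_of_L_one_ne_zero)
    {p : ℕ} [Fact p.Prime] [(congruentNumberCurve p).IsElliptic] [(congruentNumberCurve p).IsGloballyMinimal]
    [NeZero ((congruentNumberCurve p).conductorNorm ℤ)] (hp8 : p % 8 = 7) {q l : ℕ}
    (hq : q.Prime) (hq8 : q % 8 = 3) (hl : l.Prime) (hl8 : l % 8 = 5) (hJq : jacobiSym (q : ℤ) p = 1)
    (hJl : jacobiSym (l : ℤ) p = -1)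
    (hh : ∀ (K : Type) [Field K] [NumberField K], IsImaginaryQuadratic K →
      NumberField.discr K = -((q * l : ℕ) : ℤ) → NumberField.classNumber K < p) :
    ∃ (K : Type) (_ : Field K) (_ : NumberField K),
      IsImaginaryQuadratic K ∧ 4 < (NumberField.discr K).natAbs ∧
      SatisfiesHeegnerHypothesis ((congruentNumberCurve p).conductorNorm ℤ) K ∧
      ((congruentNumberCurve p).quadraticTwist (NumberField.discr K : ℚ)).entireLFunction 1 ≠ 0 ∧
      NumberField.classNumber K < p ∧ ¬ p ∣ NumberField.classNumber K := by
  have hp : p.Prime := Fact.out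
  have hp4 : p % 4 = 3 := by omega
  have hqp : q ≠ p := ne_of_jacobiSym_ne_zero hp (by rw [hJq]; norm_num)
  have hlp : l ≠ p := ne_of_jacobiSym_ne_zero hp (by rw [hJl]; norm_num)
  have hdet := det_monskyMatrixOdd_cell_seven_mod_eight (p := p) hp hq hl hp8 hq8 hl8 hJl
  obtain ⟨-, -, -, hL⟩ := analyticRank_eq_zero_of_det_odd_fourFacts hM hBT hBF hp hq hl (by omega) (by omega) (by omega)
    (Ne.symm hqp) (Ne.symm hlp) (by rintro rfl; omega) hdet
  obtain ⟨K, iF, iN, hK, hdK, hH', hcl⟩ := exists_witnessField_of (N := (congruentNumberCurve p).conductorNorm ℤ)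
    hq hq8 hl hl8 (jacobiSym_neg_mul_eq_one hp4 hJq hJl) hh
    (fun r hr hrN => eq_two_or_eq_of_prime_dvd_conductorNorm_p hp hr hrN)
  refine ⟨K, iF, iN, hK, ?_, hH', ?_, hcl, fun hdvd =>
    absurd (Nat.le_of_dvd (NumberField.classNumber_pos K) hdvd) (not_le.mpr hcl)⟩
  · rw [hdK, Int.natAbs_neg, Int.natAbs_natCast]
    have h2 : 2 ≤ q := hq.two_le
    have h5' : 5 ≤ l := by have := hl.two_le; omega
    calc 4 < 2 * 5 := by norm_num
      _ ≤ q * l := Nat.mul_le_mul h2 h5'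
  · rw [hdK, quadraticTwist_congruentNumberCurve, Int.natAbs_neg, Int.natAbs_natCast]
    exact hL

/-- **The class-number-formula threshold at the census height**: a partner `q₀ ≤ y` with `y ≥ 20` and `y² < p` satisfies
`8⁸ (2q₀)⁵ ≤ (2.718·3.1415)⁸ · p³` (the hypothesis `hkey` of `cellData_partnerQ` with `P = p`): `(2q₀)⁵ ≤ 32 y⁵`,
`p³ ≥ y⁶ ≥ 20 y⁵`, and `8⁸·32 ≤ 20·(2.718·3.1415)⁸` numerically. [folklore] -/
theorem threshold_of_le_height {p q₀ y : ℕ} (hy : 20 ≤ y) (hq₀y : q₀ ≤ y) (hyp : y ^ 2 < p) :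
    (8 : ℝ) ^ 8 * ((2 * q₀ : ℕ) : ℝ) ^ 5 ≤ (2.718 * 3.1415) ^ 8 * (p : ℝ) ^ 3 := by
  have hnum : (8 : ℝ) ^ 8 * 32 ≤ 20 * (2.718 * 3.1415) ^ 8 := by norm_num
  have hy' : (20 : ℝ) ≤ y := by exact_mod_cast hy
  have hq' : (q₀ : ℝ) ≤ y := by exact_mod_cast hq₀y
  have hp' : ((y : ℝ)) ^ 2 ≤ p := by exact_mod_cast hyp.le
  have hq0 : (0 : ℝ) ≤ q₀ := Nat.cast_nonneg _
  have hy0 : (0 : ℝ) ≤ y := Nat.cast_nonneg _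
  have h1 : ((2 * q₀ : ℕ) : ℝ) ^ 5 ≤ 32 * (y : ℝ) ^ 5 := by
    push_cast
    rw [mul_pow]
    norm_num
    exact pow_le_pow_left₀ hq0 hq' 5
  have h2 : 20 * (y : ℝ) ^ 5 ≤ (p : ℝ) ^ 3 := by
    calc 20 * (y : ℝ) ^ 5 ≤ y * (y : ℝ) ^ 5 := by gcongr
      _ = ((y : ℝ) ^ 2) ^ 3 := by ring
      _ ≤ (p : ℝ) ^ 3 := by gcongr
  calc (8 : ℝ) ^ 8 * ((2 * q₀ : ℕ) : ℝ) ^ 5 ≤ (8 : ℝ) ^ 8 * (32 * (y : ℝ) ^ 5) := by gcongr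
    _ = ((8 : ℝ) ^ 8 * 32) * (y : ℝ) ^ 5 := by ring
    _ ≤ (20 * (2.718 * 3.1415) ^ 8) * (y : ℝ) ^ 5 := by gcongr
    _ = (2.718 * 3.1415) ^ 8 * (20 * (y : ℝ) ^ 5) := by ring
    _ ≤ (2.718 * 3.1415) ^ 8 * (p : ℝ) ^ 3 := by gcongr

open scoped Classical in
/-- ★★ **The `E_p` rung for all but `O(log⁸ Q)` primes, modulo the door's three facts.** Granted Monsky (odd), Burungale–Tian
and Burungale–Flach — exactly the hypotheses of `…CornersThreeFacts.cruxOnEpCorner_of_three_facts` — there is an absolute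
`C > 0` such that for every `Q ≥ 3` some set `E` of at most `C · (log Q)⁸` naturals has the property: EVERY prime
`p ≡ 7 (mod 8)` with `⌊√Q⌋ < p ≤ Q`, `p ∉ E`, satisfies the conclusion of crux `HeegnerTwistCouplingInSupply` for
`W = E_p : y² = x³ − p²x` — a Heegner field `K′` of `N(E_p)` with `4 < |d_{K′}|`, `L(E_p^{(d_{K′})}, 1) ≠ 0`, `h(K′) < p`,
`p ∤ h(K′)`. `E` is the exceptional set of `residualCensusEp` (beyond its threshold; all of `[0, Q]` below it): outside it a
partner `q₀ ≤ Q^{1/4}`, `q₀ ≡ 3 (mod 8)`, `(p/q₀) = −1` exists, `cellData_partnerQ` (three-squares pin + class number formula,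
threshold `threshold_of_le_height`) supplies the cell, and `cruxOnEpCorner_of_cellData_of_three_facts` concludes. RUNG-LEVEL;
the crux (all `W`, all `p`) is NOT closed; BSD is not proved. [cite: Montgomery1978, p. 561] [cite: BurungaleTian2026, Thm. 1.1]
[cite: Oesterle1988Gauss, II §3 Proposition p. 57 (27)] -/
theorem cruxConclusion_Ep_allBut_of_three_facts (hM : monsky_card_selmerGroup_two_odd)
    (hBT : burungaleTian_analyticRank_eq_zero_of_selmerCorank_eq_zero_of_hasCM) (hBF : bsdTriple_of_hasCM_of_L_one_ne_zero) :
    ∃ C : ℝ, 0 < C ∧ ∀ Q : ℕ, 3 ≤ Q → ∃ E : Finset ℕ, (E.card : ℝ) ≤ C * Real.log Q ^ 8 ∧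
      ∀ (p : ℕ) [Fact p.Prime] [(congruentNumberCurve p).IsElliptic] [(congruentNumberCurve p).IsGloballyMinimal]
        [NeZero ((congruentNumberCurve p).conductorNorm ℤ)],
        p % 8 = 7 → Nat.sqrt Q < p → p ≤ Q → p ∉ E →
        ∃ (K : Type) (_ : Field K) (_ : NumberField K),
          IsImaginaryQuadratic K ∧ 4 < (NumberField.discr K).natAbs ∧
          SatisfiesHeegnerHypothesis ((congruentNumberCurve p).conductorNorm ℤ) K ∧
          ((congruentNumberCurve p).quadraticTwist (NumberField.discr K : ℚ)).entireLFunction 1 ≠ 0 ∧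
          NumberField.classNumber K < p ∧ ¬ p ∣ NumberField.classNumber K := by
  obtain ⟨C, hC, hcensus⟩ := residualCensusEp
  -- below `Q₁ = 160000` (`⌊⌊√Q⌋^{1/2}⌋ < 20`) take `E = [0, Q]`
  refine ⟨max C (160001 : ℝ), lt_max_of_lt_left hC, fun Q hQ3 => ?_⟩
  have hlog3 : 1 ≤ Real.log Q := by
    have hQ3' : (3 : ℝ) ≤ Q := by exact_mod_cast hQ3
    have he : Real.exp 1 ≤ (Q : ℝ) := le_trans (le_of_lt (lt_trans Real.exp_one_lt_d9 (by norm_num))) hQ3'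
    rwa [← Real.log_le_log_iff (Real.exp_pos 1) (by linarith), Real.log_exp] at he
  have hlog8 : 1 ≤ Real.log Q ^ 8 := one_le_pow₀ hlog3
  by_cases hQ : 160000 ≤ Q
  · refine ⟨_, le_trans (hcensus Q hQ3) (mul_le_mul_of_nonneg_right (le_max_left _ _) (by positivity)), ?_⟩
    intro p _ _ _ _ hp8 hyp hpQ hpE
    have hp : p.Prime := Fact.out
    have hy20 : 20 ≤ Nat.sqrt (Nat.sqrt Q) := by
      rw [Nat.le_sqrt', Nat.le_sqrt']; exact hQ
    -- a partner below the height
    have hpart : ∃ q₀ : ℕ, q₀.Prime ∧ q₀ % 8 = 3 ∧ q₀ ≤ Nat.sqrt (Nat.sqrt Q) ∧ jacobiSym (p : ℤ) q₀ = -1 := by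
      by_contra hne
      apply hpE
      rw [Finset.mem_filter, Finset.mem_range]
      refine ⟨by omega, hp, hp8, hyp, fun q hq hq8 hqy hJ => hne ⟨q, hq, hq8, hqy, hJ⟩⟩
    obtain ⟨q₀, hq₀, hq₀8, hq₀y, hJ⟩ := hpart
    have hysq : Nat.sqrt (Nat.sqrt Q) ^ 2 < p := lt_of_le_of_lt (Nat.sqrt_le' (Nat.sqrt Q)) hyp
    obtain ⟨q, l, hq, hq8, hl, hl8, hJq, hJl, hh⟩ :=
      cellData_partnerQ hp hp8 hq₀ hq₀8 (P := p) (threshold_of_le_height hy20 hq₀y hysq) hJ le_rfl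
    exact cruxOnEpCorner_of_cellData_of_three_facts hM hBT hBF hp8 hq hq8 hl hl8 hJq hJl hh
  · refine ⟨Finset.range (Q + 1), ?_, ?_⟩
    · have hQ' : Q < 160000 := not_le.mp hQ
      have h1 : ((Finset.range (Q + 1)).card : ℝ) ≤ 160001 := by
        rw [Finset.card_range]; exact_mod_cast (by omega : Q + 1 ≤ 160001)
      calc ((Finset.range (Q + 1)).card : ℝ) ≤ 160001 := h1
        _ ≤ max C 160001 := le_max_right _ _
        _ = max C 160001 * 1 := (mul_one _).symm
        _ ≤ max C 160001 * Real.log Q ^ 8 :=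
            mul_le_mul_of_nonneg_left hlog8 (le_trans (by positivity) (le_max_right _ _))
    · intro p _ _ _ _ _ _ hpQ hpE
      exact absurd (Finset.mem_range.mpr (by omega)) hpE

end Summit.BirchSwinnertonDyer.BirchSwinnertonDyer.Theorems.LinnikCensus
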